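import Literature.NumberTheory.NumberFields.CubicFieldIntegers
import Literature.NumberTheory.NumberFields.CubicFieldConductor
import Mathlib.RingTheory.Polynomial.GaussLemma
import Mathlib.Algebra.Polynomial.Eval.Irreducible
import HarnessLib

/-!
# Explicit cubic number fields: Dedekind–Kummer at primes not dividing the conductor

Continuation of `CubicFieldIntegers.lean` / `CubicFieldConductor.lean` for `K = ℚ(θ)`, `θ` a
root of the monic irreducible `f = X³ + aX² + bX + c ∈ ℤ[X]`. The Dedekind–Kummer statements of
`CubicFieldIntegers.lean` assumed `𝓞 K = ℤ[θ]` through the square-factor hypothesis on `Δ(f)`;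
here they are restated under Mathlib's natural hypothesis `p ∤ exponent(θ)` (the index of the
conductor), together with the two ways it is met in the tree:

* `adjoin_thetaInt_eq_top_of_forall_mem` / `mem_conductor_of_mul_mem` / `exponent_dvd`:
  from `N · 𝓞 K ⊆ ℤ[θ]` (stated in `K`), `(N) ⊆ 𝔣_θ` and `exponent(θ) ∣ N`; so `p ∤ N` gives
  `p ∤ exponent(θ)` (`not_dvd_exponent`), and `N = 1` gives `ℤ[θ] = 𝓞 K`;
* `exists_factor_of_mem_primesOver'`, `eq_span_of_no_root'`, `isPrincipal_of_unique_root'`,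
  `eq_span_pair_of_root'`: primes above `p ∤ exponent(θ)` correspond to monic irreducible factors
  of `f mod p` (Mathlib `NumberField.Ideal.primesOverSpanEquivMonicFactorsMod`); `f` with no
  root mod `p` ⟹ the prime above `p` is `(p)`; a prime of residue degree one is `(p, θ - r)` for a
  root `r` of `f mod p`.

All proved. [cite: Marcus2018, Ch. 3, Thm. 27]

## References

* D. A. Marcus, *Number Fields*, 2nd ed. (2018), Ch. 3, Thm. 27 (Dedekind–Kummer) and Ex. 3.20
  (the conductor). [cite: Marcus2018, Ch. 3, Thm. 27]
-/

noncomputable section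

open Polynomial Module NumberField Ideal
open scoped NumberField

namespace Literature.NumberTheory.NumberFields

namespace MonicCubic

variable {K : Type*} [Field K] [NumberField K] {a b c : ℤ} {θ : K}

/-! ### From `N · 𝓞 K ⊆ ℤ[θ]` to the exponent -/

/-- `ℤ[θ]` in `K` and in `𝓞 K`: an algebraic integer that is an integer polynomial in `θ` inside
`K` is one inside `𝓞 K`. [folklore] -/
theorem mem_adjoin_thetaInt_of_mem (hθ : aeval θ (poly a b c) = 0) {x : 𝓞 K}
    (hx : (x : K) ∈ Algebra.adjoin ℤ ({θ} : Set K)) :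
    x ∈ Algebra.adjoin ℤ ({thetaInt hθ} : Set (𝓞 K)) := by
  rw [Algebra.adjoin_singleton_eq_range_aeval] at hx ⊢
  obtain ⟨g, hg⟩ := hx
  refine ⟨g, ?_⟩
  apply IsFractionRing.injective (𝓞 K) K
  change algebraMap (𝓞 K) K (aeval (thetaInt hθ) g) = (x : K)
  rw [← aeval_algebraMap_apply]
  exact hg

/-- **`N ∈ 𝔣_θ`**: if `N x ∈ ℤ[θ]` for all algebraic integers `x`, then `N` lies in the conductor
of `ℤ[θ]`. [cite: Marcus2018, Ch. 3, Ex. 20] -/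
theorem mem_conductor_of_mul_mem (hθ : aeval θ (poly a b c) = 0) {N : ℕ}
    (hN : ∀ x : 𝓞 K, (N : K) * x ∈ Algebra.adjoin ℤ ({θ} : Set K)) :
    ((N : ℤ) : 𝓞 K) ∈ conductor ℤ (thetaInt hθ) := by
  rw [mem_conductor_iff]
  intro y
  refine mem_adjoin_thetaInt_of_mem hθ ?_
  have := hN y
  push_cast
  simpa only [RingOfIntegers.coe_eq_algebraMap, map_mul, map_natCast] using this

/-- **`exponent(θ) ∣ N`** whenever `N · 𝓞 K ⊆ ℤ[θ]`. [cite: Marcus2018, Ch. 3, Ex. 20] -/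
theorem exponent_dvd (hθ : aeval θ (poly a b c) = 0) {N : ℕ}
    (hN : ∀ x : 𝓞 K, (N : K) * x ∈ Algebra.adjoin ℤ ({θ} : Set K)) :
    RingOfIntegers.exponent (thetaInt hθ) ∣ N := by
  have h := Int.cast_mem_ideal_iff.mp (mem_conductor_of_mul_mem hθ hN)
  rw [RingOfIntegers.exponent]
  exact_mod_cast h

/-- `p ∤ exponent(θ)` for a prime `p ∤ N`, `N · 𝓞 K ⊆ ℤ[θ]`. [cite: Marcus2018, Ch. 3, Ex. 20] -/
theorem not_dvd_exponent (hθ : aeval θ (poly a b c) = 0) {N : ℕ}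
    (hN : ∀ x : 𝓞 K, (N : K) * x ∈ Algebra.adjoin ℤ ({θ} : Set K)) {p : ℕ} (hp : ¬ p ∣ N) :
    ¬ p ∣ RingOfIntegers.exponent (thetaInt hθ) := fun h =>
  hp (h.trans (exponent_dvd hθ hN))

/-- **`ℤ[θ] = 𝓞 K` from `1 · 𝓞 K ⊆ ℤ[θ]`** (the case `N = 1`, e.g. after removing all of `Δ(f)` by
Eisenstein arguments). [cite: Marcus2018, Ch. 3, Thm. 27] -/
theorem adjoin_thetaInt_eq_top_of_forall_mem (hθ : aeval θ (poly a b c) = 0)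
    (h1 : ∀ x : 𝓞 K, (x : K) ∈ Algebra.adjoin ℤ ({θ} : Set K)) :
    Algebra.adjoin ℤ ({thetaInt hθ} : Set (𝓞 K)) = ⊤ :=
  Algebra.eq_top_iff.mpr fun _ => mem_adjoin_thetaInt_of_mem hθ (h1 _)

/-! ### Dedekind–Kummer under `p ∤ exponent(θ)` -/

/-- **Dedekind–Kummer**: a prime `P` of `𝓞 K` above `p ∤ exponent(θ)` is `(p, Q(θ))` for any
integer lift `Q` of the corresponding monic irreducible factor `Q̄` of `f mod p`, of residue degree
`deg Q̄` (Mathlib `NumberField.Ideal.primesOverSpanEquivMonicFactorsMod`).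
[cite: Marcus2018, Ch. 3, Thm. 27] -/
theorem exists_factor_of_mem_primesOver' (hirr : Irreducible (polyQ a b c))
    (hθ : aeval θ (poly a b c) = 0) {p : ℕ} (hp : p.Prime)
    (hexp : ¬ p ∣ RingOfIntegers.exponent (thetaInt hθ)) {P : Ideal (𝓞 K)}
    (hP : P ∈ primesOver (span {(p : ℤ)}) (𝓞 K)) :
    ∃ Qb : (ZMod p)[X], Irreducible Qb ∧ Qb.Monic ∧ Qb ∣ polyMod a b c p ∧
      P.inertiaDeg ℤ = Qb.natDegree ∧
      ∀ Q : ℤ[X], Q.map (Int.castRingHom (ZMod p)) = Qb →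
        P = span {(p : 𝓞 K), aeval (thetaInt hθ) Q} := by
  haveI := Fact.mk hp
  set e := NumberField.Ideal.primesOverSpanEquivMonicFactorsMod (K := K) hexp with he
  set Qb := e ⟨P, hP⟩ with hQb
  have hmem : (Qb : (ZMod p)[X]) ∈ RingOfIntegers.monicFactorsMod (thetaInt hθ) p := Qb.2
  have hmem' := hmem
  simp only [RingOfIntegers.monicFactorsMod, Multiset.mem_toFinset,
    minpoly_thetaInt hirr hθ] at hmem'
  have h0 : polyMod a b c p ≠ 0 := (monic_polyMod a b c p).ne_zero
  obtain ⟨hirr', hmon, hdvd⟩ := (Polynomial.mem_normalizedFactors_iff h0).mp hmem'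
  refine ⟨Qb, hirr', hmon, hdvd, ?_, ?_⟩
  · have := NumberField.Ideal.inertiaDeg_primesOverSpanEquivMonicFactorsMod_symm_apply' hexp hmem
    rwa [show (⟨(Qb : (ZMod p)[X]), hmem⟩ :
        RingOfIntegers.monicFactorsMod (thetaInt hθ) p) = Qb from Subtype.ext rfl,
      Equiv.symm_apply_apply] at this
  · intro Q hQ
    have hmemQ : Q.map (Int.castRingHom (ZMod p)) ∈
        RingOfIntegers.monicFactorsMod (thetaInt hθ) p := hQ ▸ hmem
    have h1 := NumberField.Ideal.primesOverSpanEquivMonicFactorsMod_symm_apply_eq_span hexp hmemQ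
    have h2 : (⟨Q.map (Int.castRingHom (ZMod p)), hmemQ⟩ :
        RingOfIntegers.monicFactorsMod (thetaInt hθ) p) = Qb := Subtype.ext hQ
    rw [h2, hQb, Equiv.symm_apply_apply] at h1
    exact h1

/-- **Inert primes are `(p)`**: if `f` has no root modulo `p ∤ exponent(θ)`, every prime of
`𝓞 K` above `p` is `(p)`. [cite: Marcus2018, Ch. 3, Thm. 27] -/
theorem eq_span_of_no_root' (hirr : Irreducible (polyQ a b c)) (hθ : aeval θ (poly a b c) = 0)
    {p : ℕ} (hp : p.Prime) (hexp : ¬ p ∣ RingOfIntegers.exponent (thetaInt hθ))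
    {P : Ideal (𝓞 K)} (hP : P ∈ primesOver (span {(p : ℤ)}) (𝓞 K))
    (hnr : ∀ r : ZMod p, r ^ 3 + (a : ZMod p) * r ^ 2 + (b : ZMod p) * r + (c : ZMod p) ≠ 0) :
    P = span {(p : 𝓞 K)} := by
  haveI := Fact.mk hp
  obtain ⟨Qb, hirr', hmon, hdvd, -, hspan⟩ := exists_factor_of_mem_primesOver' hirr hθ hp hexp hP
  have hfirr : Irreducible (polyMod a b c p) := by
    refine irreducible_of_degree_le_three_of_not_isRoot
      (by rw [natDegree_polyMod]; decide) fun r hr => hnr r ?_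
    rwa [IsRoot.def, eval_polyMod] at hr
  have hQb : Qb = polyMod a b c p :=
    eq_of_monic_of_associated hmon (monic_polyMod a b c p) (hirr'.associated_of_dvd hfirr hdvd)
  have h := hspan (poly a b c) (by rw [hQb]; rfl)
  rw [aeval_thetaInt hθ] at h
  rw [h, Ideal.span_insert, Ideal.span_singleton_eq_bot.mpr rfl, sup_bot_eq]

/-- **Degree-one primes are `(p, θ - r)`**: a prime `P` above `p ∤ exponent(θ)` of residue degree
one (here: `p ^ f_P ≤ U < p²`) is `(p, θ - r)` for some root `r` of `f mod p`.
[cite: Marcus2018, Ch. 3, Thm. 27] -/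
theorem eq_span_pair_of_root' (hirr : Irreducible (polyQ a b c)) (hθ : aeval θ (poly a b c) = 0)
    {p : ℕ} (hp : p.Prime) (hexp : ¬ p ∣ RingOfIntegers.exponent (thetaInt hθ))
    {P : Ideal (𝓞 K)} (hP : P ∈ primesOver (span {(p : ℤ)}) (𝓞 K)) {U : ℕ}
    (hle : p ^ P.inertiaDeg ℤ ≤ U) (hU : U < p ^ 2) :
    ∃ r : ℤ, (r : ZMod p) ^ 3 + (a : ZMod p) * (r : ZMod p) ^ 2 + (b : ZMod p) * r +
        (c : ZMod p) = 0 ∧ P = span {(p : 𝓞 K), thetaInt hθ - (r : 𝓞 K)} := by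
  haveI := Fact.mk hp
  obtain ⟨Qb, hirr', hmon, hdvd, hdeg, hspan⟩ :=
    exists_factor_of_mem_primesOver' hirr hθ hp hexp hP
  have hQb1 : Qb.natDegree = 1 := by
    have h1 : 1 ≤ Qb.natDegree := by
      rcases Nat.eq_zero_or_pos Qb.natDegree with h0 | h0
      · exact absurd (Polynomial.eq_one_of_monic_natDegree_zero hmon h0 ▸ isUnit_one)
          hirr'.not_isUnit
      · exact h0
    by_contra hne
    have h2 : 2 ≤ Qb.natDegree := by omega
    have : p ^ 2 ≤ p ^ P.inertiaDeg ℤ := Nat.pow_le_pow_right hp.pos (hdeg ▸ h2)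
    omega
  have hQbeq : Qb = X + C (Qb.coeff 0) := hmon.eq_X_add_C hQb1
  set r : ℤ := ((-Qb.coeff 0).val : ℤ) with hr
  have hrc : (r : ZMod p) = -Qb.coeff 0 := by
    rw [hr, Int.cast_natCast]; exact ZMod.natCast_zmod_val _
  refine ⟨r, ?_, ?_⟩
  · have hroot : (polyMod a b c p).IsRoot (-Qb.coeff 0) := by
      rw [← dvd_iff_isRoot, map_neg, sub_neg_eq_add, ← hQbeq]
      exact hdvd
    rw [IsRoot.def, eval_polyMod] at hroot
    rw [hrc]; exact hroot
  · have hQb' : (X - C r : ℤ[X]).map (Int.castRingHom (ZMod p)) = Qb := by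
      rw [Polynomial.map_sub, map_X, map_C, eq_intCast, hrc, map_neg, sub_neg_eq_add, ← hQbeq]
    have hPeq := hspan (X - C r) hQb'
    simpa only [map_sub, aeval_X, aeval_C, algebraMap_int_eq, Int.coe_castRingHom] using hPeq

/-! ### Irreducibility from a prime of inertia; prime elements from norms -/

/-- **A monic integer cubic with no root modulo `p` is irreducible over `ℚ`** (reduction mod `p`
and Gauss's lemma). [folklore] -/
theorem irreducible_polyQ_of_no_root {a b c : ℤ} (p : ℕ) [hp : Fact p.Prime]
    (hnr : ∀ r : ZMod p, r ^ 3 + (a : ZMod p) * r ^ 2 + (b : ZMod p) * r + (c : ZMod p) ≠ 0) :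
    Irreducible (polyQ a b c) := by
  have hfirr : Irreducible (polyMod a b c p) := by
    refine irreducible_of_degree_le_three_of_not_isRoot
      (by rw [natDegree_polyMod]; decide) fun r hr => hnr r ?_
    rwa [IsRoot.def, eval_polyMod] at hr
  have hZ : Irreducible (poly a b c) :=
    Monic.irreducible_of_irreducible_map (Int.castRingHom (ZMod p)) _ (monic_poly a b c) hfirr
  rw [polyQ]
  exact ((monic_poly a b c).irreducible_iff_irreducible_map_fraction_map (K := ℚ)).mp hZ

omit [NumberField K] in
/-- An algebraic integer whose norm has prime absolute value is a prime element. [folklore] -/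
theorem prime_of_natAbs_norm_prime [NumberField K] {x : 𝓞 K}
    (hx : ((Algebra.norm ℤ x).natAbs).Prime) : Prime x := by
  have hI : (span {x}).IsPrime :=
    Ideal.isPrime_of_irreducible_absNorm (by rw [Ideal.absNorm_span_singleton]; exact hx)
  have hx0 : x ≠ 0 := by
    intro h0
    rw [h0, Algebra.norm_zero, Int.natAbs_zero] at hx
    exact Nat.not_prime_zero hx
  exact (Ideal.span_singleton_prime hx0).mp hI

omit [NumberField K] in
/-- **Primes from a full set of conjugate generators**: if a prime ideal `P` contains a product
`γ₁ γ₂ γ₃` of prime elements, it is one of the `(γᵢ)`; so if `(p) = (γ₁)(γ₂)(γ₃)` up to a unit,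
every prime above `p` is principal. [folklore] -/
theorem eq_span_singleton_of_prod_mem [NumberField K] {P : Ideal (𝓞 K)} (hP : P.IsPrime)
    {γ₁ γ₂ γ₃ : 𝓞 K} (h₁ : Prime γ₁) (h₂ : Prime γ₂) (h₃ : Prime γ₃)
    (hmem : γ₁ * γ₂ * γ₃ ∈ P) : P = span {γ₁} ∨ P = span {γ₂} ∨ P = span {γ₃} := by
  have key : ∀ {γ : 𝓞 K}, Prime γ → γ ∈ P → P = span {γ} := fun {γ} hγ hγP => by
    have hmax : (span {γ}).IsMaximal :=
      ((Ideal.span_singleton_prime hγ.ne_zero).mpr hγ).isMaximal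
        (by rw [Ne, Ideal.span_singleton_eq_bot]; exact hγ.ne_zero)
    exact (hmax.eq_of_le hP.ne_top ((Ideal.span_singleton_le_iff_mem P).mpr hγP)).symm
  rcases hP.mem_or_mem hmem with h | h
  · rcases hP.mem_or_mem h with h | h
    · exact Or.inl (key h₁ h)
    · exact Or.inr (Or.inl (key h₂ h))
  · exact Or.inr (Or.inr (key h₃ h))

end MonicCubic

end Literature.NumberTheory.NumberFields

end
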